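import Summits.AnomalousDissipation.AnomalousDissipation.Theorems.SolenoidalFractalHomogenisationLagrangianStepFlatBilinearBookkeeping
import HarnessLib

/-!
# K1L_D (stmt-AnomalousDissipation-27980), §9z glue v2, step (d): TEMPLATE BOOKKEEPING of the (V_modEC) error on the two refresh pieces
# (helper; `--supports … --as helper`; lead-k1l-onelevel-p1 g5; memo L12 §3(d))

Pure real inequalities.  On a refresh piece the (V_modEC) error is `η = Cm·(Cm·(ν^σ + (⌈K/ν⌉/n)^σ + θ^σ + (nC/n)^σ) + (min 1 (P/τ))^σ)`
(`P` = cell period = `a·physPeriod`, `τ` = cell length of the piece).  Under the template of the registered texts, read at level `m+1` with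
`ρ = N m / N (m+1) ∈ (0,1]`: `ν ≤ ρ^{1/4}` (T2), `⌈K/ν⌉/n ≤ 2ρ^{1/4}` (T3 + lacunarity), `θ ≤ Cα·θ₀·ρ^{1/16}` (decay link + T4),
`nC/n ≤ ϱ·ρ` (decay link), `physPeriod ≤ ρ^{1/16}·R` (T5), this file proves with `σz := min σ (1/2) / 16` and `cA := 1 + 2^σ + (Cαθ₀)^σ + ϱ^σ`:
* `smallTerms_le` — `ν^σ + (⌈K/ν⌉/n)^σ + θ^σ + (nC/n)^σ ≤ cA·ρ^{σz}`;
* `min_rpow_mul_sqrt_le` — the post-refresh piece: `(min 1 (P'/τ₂))^σ · √(τ₂/R) ≤ (P'/R)^{min σ ½}` (`0 < τ₂ ≤ R`; cap + `√` beat the short length);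
* `eta_full_le`, `eta_short_le`, `eta_short_mul_sqrt_le` — `η₁ ≤ Cη·ρ^{σz}`, `η₂ ≤ Cη`, `η₂·√(τ₂/R) ≤ Cη·ρ^{σz}`, `Cη = Cm(Cm·cA + 1)`;
* `glueConstant_le` — the composite constant `(η₂(√(2·Cmono·(τ₂/R)) + √2·η₁) + η₁)·CN ≤ Cz·ρ^{σz}`,
  `Cz = CN·Cη·(√(2Cmono) + √2·Cη + 1)`.
NOT a proof of any registered stub, of the crux, or of AD; rung F-D1.A0.
-/

set_option linter.dupNamespace false  -- the summit-side namespace `Summit.AnomalousDissipation.AnomalousDissipation.…` repeats a component by design (D-0017)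

noncomputable section

namespace Summit.AnomalousDissipation.AnomalousDissipation.Theorems.SolenoidalFractalHomogenisation.LagrangianStep.Z7Glue

open Real
open Summit.AnomalousDissipation.AnomalousDissipation.Theorems.SolenoidalFractalHomogenisation.LagrangianStep (FlatWindow.rpow_le_rpow_of_le_one)

/-! ## §1 Elementary `rpow` facts on `(0,1]` -/

/-- `x ≤ c·ρ^e` with `x, c ≥ 0`, `σ > 0` ⇒ `x^σ ≤ c^σ·ρ^{eσ}` (`ρ ≥ 0`). -/
theorem rpow_le_of_le_mul_rpow {x c ρ e σ : ℝ} (hx : 0 ≤ x) (hc : 0 ≤ c) (hρ : 0 ≤ ρ) (hσ : 0 ≤ σ) (h : x ≤ c * ρ ^ e) :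
    x ^ σ ≤ c ^ σ * ρ ^ (e * σ) := by
  calc x ^ σ ≤ (c * ρ ^ e) ^ σ := Real.rpow_le_rpow hx h hσ
    _ = c ^ σ * (ρ ^ e) ^ σ := Real.mul_rpow hc (Real.rpow_nonneg hρ e)
    _ = c ^ σ * ρ ^ (e * σ) := by rw [← Real.rpow_mul hρ]

/-- The exponent of record: `σz = min σ (1/2) / 16`; it is positive and at most `σ/16`, `σ/4`, `σ`, `min σ ½`. -/
theorem sigmaz_facts {σ : ℝ} (hσ : 0 < σ) :
    0 < min σ (1 / 2) / 16 ∧ min σ (1 / 2) / 16 ≤ σ / 16 ∧ min σ (1 / 2) / 16 ≤ σ / 4 ∧ min σ (1 / 2) / 16 ≤ σ ∧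
      min σ (1 / 2) / 16 ≤ min σ (1 / 2) := by
  have h1 : min σ (1 / 2) ≤ σ := min_le_left _ _
  have h2 : 0 < min σ (1 / 2) := lt_min hσ (by norm_num)
  refine ⟨by positivity, by linarith, by linarith, by linarith, by linarith⟩

/-! ## §2 The four small terms -/

/-- **The four small terms of the (V_modEC) error under the template**:
`ν^σ + q^σ + θ^σ + r^σ ≤ (1 + 2^σ + (Cαθ₀)^σ + ϱ^σ)·ρ^{σz}` when `ν ≤ ρ^{1/4}`, `q ≤ 2ρ^{1/4}`, `θ ≤ Cαθ₀ρ^{1/16}`, `r ≤ ϱρ`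
(`q = ⌈K/ν⌉/n`, `r = nC/n`; all quantities nonnegative, `0 < ρ ≤ 1`). -/
theorem smallTerms_le {ν q θ r ρ σ Cα θ₀ ϱ : ℝ} (hσ : 0 < σ) (hρ0 : 0 < ρ) (hρ1 : ρ ≤ 1)
    (hν : 0 ≤ ν) (hq : 0 ≤ q) (hθ : 0 ≤ θ) (hr : 0 ≤ r) (hCα : 0 ≤ Cα) (hθ₀ : 0 ≤ θ₀) (hϱ : 0 ≤ ϱ)
    (hνρ : ν ≤ ρ ^ (1 / 4 : ℝ)) (hqρ : q ≤ 2 * ρ ^ (1 / 4 : ℝ)) (hθρ : θ ≤ Cα * θ₀ * ρ ^ (1 / 16 : ℝ)) (hrρ : r ≤ ϱ * ρ) :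
    ν ^ σ + q ^ σ + θ ^ σ + r ^ σ ≤ (1 + (2:ℝ) ^ σ + (Cα * θ₀) ^ σ + ϱ ^ σ) * ρ ^ (min σ (1 / 2) / 16) := by
  obtain ⟨hz0, hz16, hz4, hz1, _⟩ := sigmaz_facts hσ
  set e : ℝ := min σ (1 / 2) / 16 with he
  have hρe : ∀ {f : ℝ}, e ≤ f → ρ ^ f ≤ ρ ^ e := fun hf => FlatWindow.rpow_le_rpow_of_le_one hρ0 hρ1 hf
  -- `ν^σ ≤ ρ^{σ/4} ≤ ρ^e`
  have h1 : ν ^ σ ≤ 1 * ρ ^ e := by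
    have h := rpow_le_of_le_mul_rpow (c := 1) hν zero_le_one hρ0.le hσ.le (by rw [one_mul]; exact hνρ)
    rw [Real.one_rpow] at h
    refine h.trans (mul_le_mul_of_nonneg_left (hρe (by linarith)) zero_le_one)
  -- `q^σ ≤ 2^σ ρ^{σ/4}`
  have h2 : q ^ σ ≤ (2:ℝ) ^ σ * ρ ^ e := by
    have h := rpow_le_of_le_mul_rpow (c := 2) hq (by norm_num) hρ0.le hσ.le hqρ
    exact h.trans (mul_le_mul_of_nonneg_left (hρe (by linarith)) (Real.rpow_nonneg (by norm_num) σ))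
  -- `θ^σ ≤ (Cαθ₀)^σ ρ^{σ/16}`
  have h3 : θ ^ σ ≤ (Cα * θ₀) ^ σ * ρ ^ e := by
    have h := rpow_le_of_le_mul_rpow (c := Cα * θ₀) hθ (mul_nonneg hCα hθ₀) hρ0.le hσ.le hθρ
    exact h.trans (mul_le_mul_of_nonneg_left (hρe (by linarith)) (Real.rpow_nonneg (mul_nonneg hCα hθ₀) σ))
  -- `r^σ ≤ ϱ^σ ρ^σ`
  have h4 : r ^ σ ≤ ϱ ^ σ * ρ ^ e := by
    have hrρ' : r ≤ ϱ * ρ ^ (1:ℝ) := by rwa [Real.rpow_one]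
    have h := rpow_le_of_le_mul_rpow (c := ϱ) hr hϱ hρ0.le hσ.le hrρ'
    rw [one_mul] at h
    exact h.trans (mul_le_mul_of_nonneg_left (hρe hz1) (Real.rpow_nonneg hϱ σ))
  nlinarith [h1, h2, h3, h4]

/-! ## §3 The transients of the two pieces -/

/-- Full refresh piece: `(min 1 w)^σ ≤ ρ^{σz}` when `0 ≤ w ≤ ρ^{1/16}` (`w = P/τ₁ = physPeriod/R`). -/
theorem transient_full_le {w ρ σ : ℝ} (hσ : 0 < σ) (hρ0 : 0 < ρ) (hρ1 : ρ ≤ 1) (hw0 : 0 ≤ w) (hw : w ≤ ρ ^ (1 / 16 : ℝ)) :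
    (min 1 w) ^ σ ≤ ρ ^ (min σ (1 / 2) / 16) := by
  obtain ⟨_, hz16, _⟩ := sigmaz_facts hσ
  have hmin0 : 0 ≤ min 1 w := le_min zero_le_one hw0
  calc (min 1 w) ^ σ ≤ w ^ σ := Real.rpow_le_rpow hmin0 (min_le_right _ _) hσ.le
    _ ≤ (ρ ^ (1 / 16 : ℝ)) ^ σ := Real.rpow_le_rpow hw0 hw hσ.le
    _ = ρ ^ (σ / 16) := by rw [← Real.rpow_mul hρ0.le]; ring_nf
    _ ≤ ρ ^ (min σ (1 / 2) / 16) := FlatWindow.rpow_le_rpow_of_le_one hρ0 hρ1 hz16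

/-- **Post-refresh piece: the cap and the square root beat the short length.**  For `u ≥ 0` (`= P'/τ₂`), `0 < v ≤ 1` (`= τ₂/R`):
`(min 1 u)^σ · √v ≤ (u·v)^{min σ ½}`. -/
theorem min_rpow_mul_sqrt_le {u v σ : ℝ} (hσ : 0 < σ) (hu : 0 ≤ u) (hv0 : 0 < v) (hv1 : v ≤ 1) :
    (min 1 u) ^ σ * Real.sqrt v ≤ (u * v) ^ (min σ (1 / 2)) := by
  have hmin0 : 0 ≤ min 1 u := le_min zero_le_one hu
  have hmin1 : min 1 u ≤ 1 := min_le_left _ _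
  rw [Real.sqrt_eq_rpow]
  rcases le_or_gt σ (1 / 2) with hσh | hσh
  · -- `σ ≤ 1/2`: `(min 1 u)^σ ≤ u^σ`, `v^{1/2} ≤ v^σ`
    rw [min_eq_left hσh, Real.mul_rpow hu hv0.le]
    exact mul_le_mul (Real.rpow_le_rpow hmin0 (min_le_right _ _) hσ.le)
      (Real.rpow_le_rpow_of_exponent_ge hv0 hv1 hσh) (Real.rpow_nonneg hv0.le _) (Real.rpow_nonneg hu _)
  · -- `σ > 1/2`: `(min 1 u)^σ ≤ (min 1 u)^{1/2} ≤ u^{1/2}`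
    rw [min_eq_right hσh.le, Real.mul_rpow hu hv0.le]
    refine mul_le_mul_of_nonneg_right ?_ (Real.rpow_nonneg hv0.le _)
    rcases hmin0.eq_or_lt with h0 | h0
    · rw [← h0, Real.zero_rpow hσ.ne']
      exact Real.rpow_nonneg hu _
    · calc (min 1 u) ^ σ ≤ (min 1 u) ^ (1 / 2 : ℝ) := Real.rpow_le_rpow_of_exponent_ge h0 hmin1 hσh.le
        _ ≤ u ^ (1 / 2 : ℝ) := Real.rpow_le_rpow hmin0 (min_le_right _ _) (by norm_num)

/-- Post-refresh piece, template form: `(min 1 (P'/τ₂))^σ · √(τ₂/R) ≤ ρ^{σz}` when `0 ≤ P' ≤ ρ^{1/16}·R`, `0 < τ₂ ≤ R`, `0 < ρ`. -/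
theorem transient_short_mul_sqrt_le {P' τ₂ R ρ σ : ℝ} (hσ : 0 < σ) (hρ0 : 0 < ρ) (hP0 : 0 ≤ P') (hR : 0 < R)
    (hτ0 : 0 < τ₂) (hτR : τ₂ ≤ R) (hPR : P' ≤ ρ ^ (1 / 16 : ℝ) * R) :
    (min 1 (P' / τ₂)) ^ σ * Real.sqrt (τ₂ / R) ≤ ρ ^ (min σ (1 / 2) / 16) := by
  obtain ⟨_, _, _, _, hzle⟩ := sigmaz_facts hσ
  have hmpos : 0 < min σ (1 / 2) := lt_min hσ (by norm_num)
  have hv0 : 0 < τ₂ / R := div_pos hτ0 hR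
  have hv1 : τ₂ / R ≤ 1 := (div_le_one hR).2 hτR
  have huv : P' / τ₂ * (τ₂ / R) = P' / R := by field_simp
  have hw : P' / R ≤ ρ ^ (1 / 16 : ℝ) := (div_le_iff₀ hR).2 hPR
  calc (min 1 (P' / τ₂)) ^ σ * Real.sqrt (τ₂ / R) ≤ (P' / τ₂ * (τ₂ / R)) ^ (min σ (1 / 2)) :=
        min_rpow_mul_sqrt_le hσ (div_nonneg hP0 hτ0.le) hv0 hv1
    _ = (P' / R) ^ (min σ (1 / 2)) := by rw [huv]
    _ ≤ (ρ ^ (1 / 16 : ℝ)) ^ (min σ (1 / 2)) := Real.rpow_le_rpow (div_nonneg hP0 hR.le) hw hmpos.le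
    _ = ρ ^ (min σ (1 / 2) / 16) := by rw [← Real.rpow_mul hρ0.le]; ring_nf

/-! ## §4 The per-piece errors and the composite constant -/

/-- **Full piece**: `η₁ = Cm(Cm·A + (min 1 w)^σ) ≤ Cm(Cm·cA + 1)·ρ^{σz}` when `A ≤ cA·ρ^{σz}` and `(min 1 w)^σ ≤ ρ^{σz}`. -/
theorem eta_full_le {Cm A cA T ρz : ℝ} (hCm : 0 ≤ Cm) (hA : A ≤ cA * ρz) (hT : T ≤ ρz) :
    Cm * (Cm * A + T) ≤ Cm * (Cm * cA + 1) * ρz := by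
  have h1 : Cm * A ≤ Cm * (cA * ρz) := mul_le_mul_of_nonneg_left hA hCm
  nlinarith

/-- **Short piece, crude**: `η₂ = Cm(Cm·A + (min 1 u)^σ) ≤ Cm(Cm·cA + 1)` when `A ≤ cA·ρ^{σz}`, `ρ^{σz} ≤ 1`, `cA ≥ 0`, `u ≥ 0`. -/
theorem eta_short_le {Cm A cA u σ ρz : ℝ} (hCm : 0 ≤ Cm) (hcA : 0 ≤ cA) (hσ : 0 < σ) (hu : 0 ≤ u) (hA : A ≤ cA * ρz)
    (hρz1 : ρz ≤ 1) : Cm * (Cm * A + (min 1 u) ^ σ) ≤ Cm * (Cm * cA + 1) := by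
  have hT1 : (min 1 u) ^ σ ≤ 1 := Real.rpow_le_one (le_min zero_le_one hu) (min_le_left _ _) hσ.le
  have h1 : A ≤ cA := hA.trans (by nlinarith)
  have h2 : Cm * A ≤ Cm * cA := mul_le_mul_of_nonneg_left h1 hCm
  nlinarith

/-- **Short piece against the square root of its relative length**: `η₂·√v ≤ Cm(Cm·cA + 1)·ρ^{σz}` when `A ≤ cA·ρ^{σz}`,
`(min 1 u)^σ·√v ≤ ρ^{σz}`, `v ≤ 1`, `Cm, cA, ρ^{σz} ≥ 0`. -/
theorem eta_short_mul_sqrt_le {Cm A cA u v σ ρz : ℝ} (hCm : 0 ≤ Cm) (hcA : 0 ≤ cA) (hρz : 0 ≤ ρz) (hv1 : v ≤ 1)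
    (hA : A ≤ cA * ρz) (hT : (min 1 u) ^ σ * Real.sqrt v ≤ ρz) :
    Cm * (Cm * A + (min 1 u) ^ σ) * Real.sqrt v ≤ Cm * (Cm * cA + 1) * ρz := by
  have hsv0 : 0 ≤ Real.sqrt v := Real.sqrt_nonneg _
  have hsv1 : Real.sqrt v ≤ 1 := by rw [show (1:ℝ) = Real.sqrt 1 by simp]; exact Real.sqrt_le_sqrt hv1
  have h1 : Cm * A * Real.sqrt v ≤ Cm * (cA * ρz) := by
    have hCA : Cm * A ≤ Cm * (cA * ρz) := mul_le_mul_of_nonneg_left hA hCm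
    have hpos : 0 ≤ Cm * (cA * ρz) := by positivity
    calc Cm * A * Real.sqrt v ≤ Cm * (cA * ρz) * Real.sqrt v := by
          rcases le_or_gt 0 (Cm * A) with h | h
          · exact mul_le_mul_of_nonneg_right hCA hsv0
          · nlinarith [mul_nonneg hpos hsv0, mul_le_mul_of_nonneg_right hCA hsv0]
      _ ≤ Cm * (cA * ρz) * 1 := mul_le_mul_of_nonneg_left hsv1 hpos
      _ = Cm * (cA * ρz) := mul_one _
  have h2 : Cm * ((min 1 u) ^ σ * Real.sqrt v) ≤ Cm * ρz := mul_le_mul_of_nonneg_left hT hCm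
  calc Cm * (Cm * A + (min 1 u) ^ σ) * Real.sqrt v = Cm * (Cm * A * Real.sqrt v) + Cm * ((min 1 u) ^ σ * Real.sqrt v) := by ring
    _ ≤ Cm * (Cm * (cA * ρz)) + Cm * ρz := add_le_add (mul_le_mul_of_nonneg_left h1 hCm) h2
    _ = Cm * (Cm * cA + 1) * ρz := by ring

/-- **The composite constant.**  With `Cη = Cm(Cm·cA+1)`: if `η₁ ≤ Cη·ρz`, `η₂ ≤ Cη`, `η₂·√v ≤ Cη·ρz` (`η₁, Cη, CN, Cmono ≥ 0`), then
`(η₂(√(2·Cmono·v) + √2·η₁) + η₁)·CN ≤ CN·Cη·(√(2·Cmono) + √2·Cη + 1)·ρz`. -/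
theorem glueConstant_le {η₁ η₂ Cη CN Cmono v ρz : ℝ} (hη₁ : 0 ≤ η₁) (hCη : 0 ≤ Cη) (hCN : 0 ≤ CN) (hCm : 0 ≤ Cmono)
    (h1 : η₁ ≤ Cη * ρz) (h2 : η₂ ≤ Cη) (h3 : η₂ * Real.sqrt v ≤ Cη * ρz) :
    (η₂ * (Real.sqrt (2 * Cmono * v) + Real.sqrt 2 * η₁) + η₁) * CN ≤ CN * Cη * (Real.sqrt (2 * Cmono) + Real.sqrt 2 * Cη + 1) * ρz := by
  have hsplit : Real.sqrt (2 * Cmono * v) = Real.sqrt (2 * Cmono) * Real.sqrt v := Real.sqrt_mul (by positivity) v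
  rw [hsplit]
  have hs2C : 0 ≤ Real.sqrt (2 * Cmono) := Real.sqrt_nonneg _
  have hs2 : 0 ≤ Real.sqrt 2 := Real.sqrt_nonneg _
  have t1 : η₂ * (Real.sqrt (2 * Cmono) * Real.sqrt v) ≤ Real.sqrt (2 * Cmono) * (Cη * ρz) := by
    calc η₂ * (Real.sqrt (2 * Cmono) * Real.sqrt v) = Real.sqrt (2 * Cmono) * (η₂ * Real.sqrt v) := by ring
      _ ≤ Real.sqrt (2 * Cmono) * (Cη * ρz) := mul_le_mul_of_nonneg_left h3 hs2C
  have t2 : η₂ * (Real.sqrt 2 * η₁) ≤ Cη * (Real.sqrt 2 * (Cη * ρz)) :=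
    mul_le_mul h2 (mul_le_mul_of_nonneg_left h1 hs2) (by positivity) hCη
  have hsum : η₂ * (Real.sqrt (2 * Cmono) * Real.sqrt v + Real.sqrt 2 * η₁) + η₁
      ≤ Cη * (Real.sqrt (2 * Cmono) + Real.sqrt 2 * Cη + 1) * ρz := by
    calc η₂ * (Real.sqrt (2 * Cmono) * Real.sqrt v + Real.sqrt 2 * η₁) + η₁
        = η₂ * (Real.sqrt (2 * Cmono) * Real.sqrt v) + η₂ * (Real.sqrt 2 * η₁) + η₁ := by ring
      _ ≤ Real.sqrt (2 * Cmono) * (Cη * ρz) + Cη * (Real.sqrt 2 * (Cη * ρz)) + Cη * ρz := add_le_add (add_le_add t1 t2) h1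
      _ = Cη * (Real.sqrt (2 * Cmono) + Real.sqrt 2 * Cη + 1) * ρz := by ring
  calc (η₂ * (Real.sqrt (2 * Cmono) * Real.sqrt v + Real.sqrt 2 * η₁) + η₁) * CN
      ≤ (Cη * (Real.sqrt (2 * Cmono) + Real.sqrt 2 * Cη + 1) * ρz) * CN := mul_le_mul_of_nonneg_right hsum hCN
    _ = CN * Cη * (Real.sqrt (2 * Cmono) + Real.sqrt 2 * Cη + 1) * ρz := by ring

end Summit.AnomalousDissipation.AnomalousDissipation.Theorems.SolenoidalFractalHomogenisation.LagrangianStep.Z7Glue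

end
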